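import Summits.HubbardSuperconductivity.HubbardSuperconductivity.Theorems.AnisotropyChordSpinMonotoneTwoMagnonRookWeightedMonotone

/-!
# Route `AnisotropyChord`: THEOREM R (weighted rook graphs) — all coupling ratios `J ≠ 1`

The analytic form `wrook_flatOverlap_antitone` (file `…RookWeightedMonotone`) is stated for the
coupling ratio `0 < J < 1` (`J₂ < J₁`).  The three-class eigen-equations are symmetric under
exchanging the two contact orbits: if `(u, v, E)` is a physical point for `(p, q, J)` at coupling
`σ`, then `(v, u, E/J)` is a physical point for `(q, p, 1/J)` at the SAME `σ` (`wrook_point_swap`),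
and the flat overlap is symmetric, `W_{p,q}(u,v) = W_{q,p}(v,u)`.  Hence the monotonicity holds for
every `J > 0`, `J ≠ 1` (`wrook_flatOverlap_antitone_of_ne_one`); the equal-weight case `J = 1` is
the tree theorem `rook_twoMagnon_condensate_monotone` (exact one-parameter solution).  Pure algebra;
no definition is introduced.
-/

set_option linter.dupNamespace false

namespace Summit.HubbardSuperconductivity.HubbardSuperconductivity.Theorems.AnisotropyChord.TwoMagnon

/-- **Orbit swap.**  A physical point `(u, v, E)` of the weighted rook quotient for `(p, q, J)` at
coupling `σ` (eigen-equations (E1)–(E3)) gives the physical point `(v, u, E/J)` for `(q, p, 1/J)` at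
the same coupling: (E1)–(E3) divided by `J`. [folklore] -/
theorem wrook_point_swap {p q J σ E u v : ℝ} (hJ : 0 < J)
    (e1 : u * (J * q + σ - E) = J * q) (e2 : v * (p + σ * J - E) = p)
    (e3 : E = (1 - v) + J * (1 - u)) :
    v * (1 / J * p + σ - E / J) = 1 / J * p ∧ u * (q + σ * (1 / J) - E / J) = q ∧
      E / J = (1 - u) + 1 / J * (1 - v) := by
  have hJ0 : J ≠ 0 := hJ.ne'
  refine ⟨?_, ?_, ?_⟩
  · field_simp
    linear_combination e2
  · field_simp
    linear_combination e1
  · field_simp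
    linear_combination e3

/-- **THEOREM R, analytic form, every coupling ratio `J ≠ 1`.**  For real `p, q ≥ 1`, `0 < J`,
`J ≠ 1`, two physical points of the weighted rook quotient at couplings `0 < σ₁ ≤ σ₂` satisfy
`W(u₂,v₂) ≤ W(u₁,v₁)`, `W(u,v) = (pu + qv + pq)²/((p + q + pq)(pu² + qv² + pq))`: the case `J < 1`
is `wrook_flatOverlap_antitone`; for `J > 1` apply it to the swapped data `(q, p, 1/J)`
(`wrook_point_swap`) and use the symmetry of `W`.  Theory seat hubbard-h0-rotor-theory-1,
ROTOR-THEORY-5 §41 (THEOREM R: all anisotropies `J₂/J₁`). [folklore] -/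
theorem wrook_flatOverlap_antitone_of_ne_one (p q J : ℝ) (hp : 1 ≤ p) (hq : 1 ≤ q) (hJ : 0 < J)
    (hJ1 : J ≠ 1) {σ₁ E₁ u₁ v₁ σ₂ E₂ u₂ v₂ : ℝ} (hσ₁ : 0 < σ₁) (h12 : σ₁ ≤ σ₂)
    (hu₁ : 0 < u₁) (hv₁ : 0 < v₁) (hu₂ : 0 < u₂) (hv₂ : 0 < v₂)
    (a1 : u₁ * (J * q + σ₁ - E₁) = J * q) (a2 : v₁ * (p + σ₁ * J - E₁) = p)
    (a3 : E₁ = (1 - v₁) + J * (1 - u₁))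
    (b1 : u₂ * (J * q + σ₂ - E₂) = J * q) (b2 : v₂ * (p + σ₂ * J - E₂) = p)
    (b3 : E₂ = (1 - v₂) + J * (1 - u₂)) :
    (p * u₂ + q * v₂ + p * q) ^ 2 / ((p + q + p * q) * (p * u₂ ^ 2 + q * v₂ ^ 2 + p * q))
      ≤ (p * u₁ + q * v₁ + p * q) ^ 2 / ((p + q + p * q) * (p * u₁ ^ 2 + q * v₁ ^ 2 + p * q)) := by
  rcases lt_or_gt_of_ne hJ1 with hlt | hgt
  · exact wrook_flatOverlap_antitone p q J hp hq hJ hlt hσ₁ h12 hu₁ hv₁ hu₂ hv₂ a1 a2 a3 b1 b2 b3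
  · -- `J > 1`: swap the orbits, coupling ratio `1/J < 1`
    have hJ' : 0 < 1 / J := by positivity
    have hJ'1 : 1 / J < 1 := (div_lt_one hJ).mpr hgt
    obtain ⟨c1, c2, c3⟩ := wrook_point_swap hJ a1 a2 a3
    obtain ⟨d1, d2, d3⟩ := wrook_point_swap hJ b1 b2 b3
    have h := wrook_flatOverlap_antitone q p (1 / J) hq hp hJ' hJ'1 hσ₁ h12 hv₁ hu₁ hv₂ hu₂
      c1 c2 c3 d1 d2 d3
    have e₁ : (q * v₁ + p * u₁ + q * p) ^ 2 / ((q + p + q * p) * (q * v₁ ^ 2 + p * u₁ ^ 2 + q * p))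
        = (p * u₁ + q * v₁ + p * q) ^ 2 / ((p + q + p * q) * (p * u₁ ^ 2 + q * v₁ ^ 2 + p * q)) := by
      ring_nf
    have e₂ : (q * v₂ + p * u₂ + q * p) ^ 2 / ((q + p + q * p) * (q * v₂ ^ 2 + p * u₂ ^ 2 + q * p))
        = (p * u₂ + q * v₂ + p * q) ^ 2 / ((p + q + p * q) * (p * u₂ ^ 2 + q * v₂ ^ 2 + p * q)) := by
      ring_nf
    rw [e₁, e₂] at h
    exact h

end Summit.HubbardSuperconductivity.HubbardSuperconductivity.Theorems.AnisotropyChord.TwoMagnon
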